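import Summits.MatrixMultiplication.MatrixMultiplication.Theses.OctonionicLaser
import Summits.MatrixMultiplication.MatrixMultiplication.Theorems.OctonionicLaserOctLaserBoundFreeDiagonal
import Literature.Computability.AlgebraicComplexity.AsymptoticSumInequalityAsymptoticRank
import Literature.Barriers.MatrixMultiplication.UniversalMethodBarrier
import Literature.Barriers.MatrixMultiplication.UniversalMethodBarrierAsymptoticRank
import Literature.Combinatorics.Additive.TricoloredSumFreeLowerBoundProofs

/-!
# Route OctonionicLaser — support item `OctLaserBound` (stmt-MatrixMultiplication-7934), proved

`(3/2^{2/3}) · 2^ω ≤ R̃(t₈)` for the structure tensor `t₈` of the complex octonions, written inline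
(as in the route file) as the Cayley–Dickson double of `M₂(ℂ)` with the adjugate as involution on the
index type `Fin 2 × Fin 2 × Fin 2` (grading bit, matrix unit).

## Proof (the card's theorem; Coppersmith–Winograd zero-out + tricolored sum-free capacity of `𝔽₂ⁿ`)

* **Blocks.** `t₈` is supported on the four coarse blocks `(o; p, q)` with `o = p + q` (grading
  bits), and each block is, up to a relabelling of the matrix units inside the block and SIGNS on
  the third slot, the matrix multiplication tensor `⟨2,2,2⟩` (`octonion_block`; e.g. block `(0;1,1)`
  is `−adj(E_q)·E_p`, block `(1;1,0)` is `E_p·adj(E_q)`; the signs cannot be removed by a global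
  diagonal change of basis — this is the non-associative twist — but they CAN be removed block by
  block, which is all a free diagonal needs).
* **Signed free diagonals** (`tensorRestrictsTo_kroneckerPow_matMulDirectSum_of_free_signed`, helper
  file `OctonionicLaserOctLaserBoundFreeDiagonal.lean`): the tree's BCS Prop. 15.30 / Thm. 15.41 layer (`LaserMethodRestriction.lean`) asks the components to be
  LITERALLY matrix tensors along index maps; we re-prove it allowing per-component sign functions
  `εI, εJ, εL` with `ε² = 1` on the three slots (a diagonal of `D^{⊗N}`-blocks meets every block of
  `t^{⊗N}` at most once, so component-wise signed relabellings glue to one restriction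
  `t^{⊗N} ≥ ⊕_{δ∈Δ} ⟨∏k, ∏m, ∏n⟩`).
* **Zero-out.** A tricolored sum-free family `x, y, z : Fin s → 𝔽₂^N` (`x i + y j + z k = 0 ↔
  i = j = k`) gives the free diagonal `δ_i = (y_i + z_i; y_i, z_i)` of blocks of `t₈^{⊗N}`, hence
  `t₈^{⊗N} ≥ s ⊙ ⟨2^N, 2^N, 2^N⟩` and, by the asymptotic sum inequality for `R̃`
  (`sum_rpow_omega_le_asymptoticRank`) and `R̃(t^{⊗N}) ≤ R̃(t)^N`, **`s · 2^{Nω} ≤ R̃(t₈)^N`**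
  (`card_mul_pow_omega_le_asymptoticRank_octonion_pow`).
* **Capacity.** Kleinberg–Sawin–Speyer 2018 Thm. 2 at `q = 2` (PROVED in tree:
  `kleinbergSawinSpeyer2018_two`): for `0 < δ < 3/2^{2/3}` and all large `N` there is such a family
  with `s ≥ (3/2^{2/3} − δ)^N`; so `(3/2^{2/3} − δ) 2^ω ≤ R̃(t₈)` for every `δ`, whence the claim.

## References

* [Blaser2013] M. Bläser, *Fast Matrix Multiplication*, ToC Graduate Surveys 5 (2013), §§7–9.
* [BurgisserClausenShokrollahi1997] BCS, *Algebraic Complexity Theory*, Prop. 15.30, Thm. 15.41.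
* [CoppersmithWinograd1990] D. Coppersmith, S. Winograd, J. Symb. Comput. 9 (1990), §§6–7.
* [KleinbergSawinSpeyer2018] R. Kleinberg, W. Sawin, D. Speyer, Discrete Analysis 2018:12, Thm. 2.
-/

noncomputable section

open scoped BigOperators
open Finset

-- the tree's namespace `Summit.MatrixMultiplication.MatrixMultiplication.…` repeats a component by design
set_option linter.dupNamespace false

namespace Summit.MatrixMultiplication.MatrixMultiplication.Theorems

open Literature.Computability.AlgebraicComplexity
open Literature.Barriers.MatrixMultiplication (asymptoticRank_le_of_polyDegeneratesTo
  asymptoticRank_kroneckerPow_le)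

/-! ## The octonion tensor `t₈` and its four blocks -/

section Octonion

-- The structure tensor `t₈` of the complex octonions EXACTLY as inlined in the route file
-- (Cayley–Dickson double of `M₂(ℂ)` with the adjugate as involution; index type
-- `Fin 2 × Fin 2 × Fin 2` = (grading bit, matrix unit); first slot = output). A local notation, not a
-- definition, so that the theorems below are literally about the route's term; `quotPrecheck` cannot
-- inspect the binders/projections of a closed notation body, hence the option (precedent: Theorems
-- files inlining route bodies verbatim).
set_option quotPrecheck false in
local notation "t₈" => (fun o p q : Fin 2 × Fin 2 × Fin 2 => (if o.1 = 0 ∧ p.1 = 0 ∧ q.1 = 0 then (Matrix.single p.2.1 p.2.2 (1:ℂ) * Matrix.single q.2.1 q.2.2 (1:ℂ)) o.2.1 o.2.2 else 0) - (if o.1 = 0 ∧ p.1 = 1 ∧ q.1 = 1 then ((Matrix.single q.2.1 q.2.2 (1:ℂ)).adjugate * Matrix.single p.2.1 p.2.2 (1:ℂ)) o.2.1 o.2.2 else 0) + (if o.1 = 1 ∧ p.1 = 0 ∧ q.1 = 1 then (Matrix.single q.2.1 q.2.2 (1:ℂ) * Matrix.single p.2.1 p.2.2 (1:ℂ)) o.2.1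 o.2.2 else 0) + (if o.1 = 1 ∧ p.1 = 1 ∧ q.1 = 0 then (Matrix.single p.2.1 p.2.2 (1:ℂ) * (Matrix.single q.2.1 q.2.2 (1:ℂ)).adjugate) o.2.1 o.2.2 else 0))

/-- Products of matrix units, entrywise: `(c E_{ij} · d E_{kl})_{ab} = [a = i][j = k][b = l] · c d`.
[folklore] -/
theorem single_mul_single_apply {ν : Type*} [Fintype ν] [DecidableEq ν] (i j k l a b : ν)
    (c d : ℂ) :
    (Matrix.single i j c * Matrix.single k l d) a b = if a = i ∧ j = k ∧ b = l then c * d else 0 := by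
  by_cases h : j = k
  · subst h
    rw [Matrix.single_mul_single_same, Matrix.single_apply]
    exact if_congr ⟨fun ⟨h1, h2⟩ => ⟨h1.symm, rfl, h2.symm⟩, fun ⟨h1, _, h2⟩ => ⟨h1.symm, h2.symm⟩⟩
      rfl rfl
  · rw [Matrix.single_mul_single_of_ne _ _ _ _ h, Matrix.zero_apply, if_neg (fun h' => h h'.2.1)]

/-- The adjugate of a matrix unit of `M₂`: `adj(c E_{ij}) = ±c E_{j+1, i+1}` (sign `+` iff `i = j`).
[folklore] -/
theorem adjugate_single_fin_two (i j : Fin 2) (c : ℂ) :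
    (Matrix.single i j c).adjugate = Matrix.single (j + 1) (i + 1) (if i = j then c else -c) := by
  ext a b
  rw [Matrix.adjugate_fin_two]
  fin_cases i <;> fin_cases j <;> fin_cases a <;> fin_cases b <;> simp

/-- **Block `(0;0,0)` of `t₈` is `⟨2,2,2⟩`** (`E_p E_q`, the matrix product itself). [folklore] -/
theorem octonion_block₀₀₀ (u v w : Fin 2 × Fin 2) :
    t₈ (0, u) (0, v) (0, w) = matMulTensor ℂ 2 2 2 u v w := by
  simp only [true_and, and_true, if_true, Fin.isValue]
  simp [single_mul_single_apply, matMulTensor]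

/-- **Block `(0;1,1)` of `t₈` is a signed relabelled `⟨2,2,2⟩`** (`−adj(E_q) E_p`; transpose the
product and conjugate the `q`-units by the adjugate; sign `−1` on the diagonal units `w.1 = w.2`).
[folklore] -/
theorem octonion_block₀₁₁ (u v w : Fin 2 × Fin 2) :
    t₈ (0, u.swap) (1, v.swap) (1, (w.1 + 1, w.2 + 1)) =
      (if w.1 = w.2 then -1 else 1) * matMulTensor ℂ 2 2 2 u v w := by
  obtain ⟨u1, u2⟩ := u; obtain ⟨v1, v2⟩ := v; obtain ⟨w1, w2⟩ := w
  revert u1 u2 v1 v2 w1 w2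
  have e1 : (1 : Fin 2) + 1 = 0 := by decide
  have e2 : (0 : Fin 2) + 1 = 1 := by decide
  simp only [Fin.forall_fin_two, Prod.swap_prod_mk]
  norm_num [adjugate_single_fin_two, single_mul_single_apply, matMulTensor, e1, e2,
    Matrix.single_apply]

/-- **Block `(1;0,1)` of `t₈` is a relabelled `⟨2,2,2⟩`** (`E_q E_p`; transpose the product).
[folklore] -/
theorem octonion_block₁₀₁ (u v w : Fin 2 × Fin 2) :
    t₈ (1, u.swap) (0, v.swap) (1, w.swap) = matMulTensor ℂ 2 2 2 u v w := by
  obtain ⟨u1, u2⟩ := u; obtain ⟨v1, v2⟩ := v; obtain ⟨w1, w2⟩ := w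
  revert u1 u2 v1 v2 w1 w2
  simp only [Fin.forall_fin_two, Prod.swap_prod_mk]
  norm_num [single_mul_single_apply, matMulTensor]

/-- **Block `(1;1,0)` of `t₈` is a signed relabelled `⟨2,2,2⟩`** (`E_p adj(E_q)`; conjugate the
`q`-units by the adjugate; sign `+1` exactly on the diagonal units `w.1 = w.2`). [folklore] -/
theorem octonion_block₁₁₀ (u v w : Fin 2 × Fin 2) :
    t₈ (1, u) (1, v) (0, (w.2 + 1, w.1 + 1)) =
      (if w.1 = w.2 then 1 else -1) * matMulTensor ℂ 2 2 2 u v w := by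
  obtain ⟨u1, u2⟩ := u; obtain ⟨v1, v2⟩ := v; obtain ⟨w1, w2⟩ := w
  revert u1 u2 v1 v2 w1 w2
  have e1 : (1 : Fin 2) + 1 = 0 := by decide
  have e2 : (0 : Fin 2) + 1 = 1 := by decide
  simp only [Fin.forall_fin_two]
  norm_num [adjugate_single_fin_two, single_mul_single_apply, matMulTensor, e1, e2,
    Matrix.single_apply]

/-- **The coarse support of `t₈`**: an entry `t₈(o, p, q)` vanishes unless the grading bits satisfy
`o = p + q` (the `ℤ/2`-grading of the Cayley–Dickson double). [folklore] -/
theorem octonion_support (a b c : Fin 2 × Fin 2 × Fin 2) (h : t₈ a b c ≠ 0) : a.1 = b.1 + c.1 := by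
  obtain ⟨a1, a2⟩ := a; obtain ⟨b1, b2⟩ := b; obtain ⟨c1, c2⟩ := c
  fin_cases a1 <;> fin_cases b1 <;> fin_cases c1 <;>
    simp only [Fin.zero_eta, Fin.mk_one, Fin.isValue] at h ⊢ <;>
    first | decide | exact (h (by simp)).elim

/-! ## Zero-out of `t₈^{⊗N}` along a tricolored sum-free family -/

/-- **`s · 2^{Nω} ≤ R̃(t₈)^N` for a tricolored sum-free family of size `s` in `𝔽₂^N`** (`N ≥ 1`):
the family `(x, y, z)` gives the free diagonal `δᵢ = (yᵢ + zᵢ; yᵢ, zᵢ)` of coarse blocks of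
`t₈^{⊗N}` (free because `xᵢ = yᵢ + zᵢ` and `xᵢ + yⱼ + z_k = 0 ↔ i = j = k`), each block a signed
relabelled `⟨2^N, 2^N, 2^N⟩`; hence `t₈^{⊗N} ≥ ⊕_{i<s} ⟨2^N,2^N,2^N⟩`
(`tensorRestrictsTo_kroneckerPow_matMulDirectSum_of_free_signed`), and the asymptotic sum inequality
for `R̃` (`sum_rpow_omega_le_asymptoticRank`) with `R̃(t^{⊗N}) ≤ R̃(t)^N` gives the bound
(Coppersmith–Winograd 1990 §7 / Bläser 2013 §8, on the carrier `t₈`).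
[cite: Blaser2013, §8 (Thm. 8.1, proof)] -/
theorem card_mul_pow_omega_le_asymptoticRank_octonion_pow {N s : ℕ} (hN : 1 ≤ N)
    (x y z : Fin s → (Fin N → ZMod 2))
    (hxyz : Literature.Combinatorics.Additive.IsTricoloredSumFree x y z) :
    (s : ℝ) * ((2 : ℝ) ^ omega ℂ) ^ N ≤ asymptoticRank t₈ ^ N := by
  classical
  -- the coarse blocks: label triples `(o; p, q)` with `o = p + q`
  set S : Finset (Fin 2 × Fin 2 × Fin 2) :=
    Finset.univ.filter (fun s => s.1 = s.2.1 + s.2.2) with hSdef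
  -- index maps and signs of the four components (`octonion_block₀₀₀`, `₀₁₁`, `₁₀₁`, `₁₁₀`)
  set πI : Fin 2 × Fin 2 × Fin 2 → Fin 2 × Fin 2 → Fin 2 × Fin 2 :=
    fun s u => if s.2.2 = 0 then u else u.swap with hπI
  set πL : Fin 2 × Fin 2 × Fin 2 → Fin 2 × Fin 2 → Fin 2 × Fin 2 := fun s w =>
    if s.2.1 = 0 then (if s.2.2 = 0 then w else w.swap)
    else (if s.2.2 = 0 then (w.2 + 1, w.1 + 1) else (w.1 + 1, w.2 + 1)) with hπL
  set ε : Fin 2 × Fin 2 × Fin 2 → Fin 2 × Fin 2 → ℂ := fun s w =>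
    if s.2.1 = 0 then 1
    else (if s.2.2 = 0 then (if w.1 = w.2 then 1 else -1) else (if w.1 = w.2 then -1 else 1)) with hε
  -- the free diagonal `δᵢ = (yᵢ + zᵢ; yᵢ, zᵢ)` (`ZMod 2 = Fin 2` definitionally)
  set d : Fin s → (Fin N → Fin 2) × (Fin N → Fin 2) × (Fin N → Fin 2) :=
    fun i => (fun ρ => (y i ρ : Fin 2) + (z i ρ : Fin 2), fun ρ => (y i ρ : Fin 2),
      fun ρ => (z i ρ : Fin 2)) with hd
  have hS : ∀ a b c : Fin 2 × Fin 2 × Fin 2, t₈ a b c ≠ 0 → (a.1, b.1, c.1) ∈ S := by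
    intro a b c h
    simp only [hSdef, Finset.mem_filter, Finset.mem_univ, true_and]
    exact octonion_support a b c h
  have hεL : ∀ s ∈ S, ∀ w : Fin 2 × Fin 2, ε s w * ε s w = 1 := by
    intro s _ w
    simp only [hε]
    split_ifs <;> norm_num
  have hmat : ∀ s ∈ S, ∀ u v w : Fin 2 × Fin 2,
      t₈ (s.1, πI s u) (s.2.1, πI s v) (s.2.2, πL s w) =
        (1 : ℂ) * 1 * ε s w * matMulTensor ℂ 2 2 2 u v w := by
    intro s hs u v w
    obtain ⟨s1, s2, s3⟩ := s
    simp only [hSdef, Finset.mem_filter, Finset.mem_univ, true_and] at hs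
    fin_cases s1 <;> fin_cases s2 <;> fin_cases s3
    all_goals first
      | exact absurd hs (by decide)
      | skip
    · convert octonion_block₀₀₀ u v w using 2 <;> simp [hπI, hπL, hε]
    · convert octonion_block₀₁₁ u v w using 2 <;> simp [hπI, hπL, hε]
    · convert octonion_block₁₀₁ u v w using 2 <;> simp [hπI, hπL, hε]
    · convert octonion_block₁₁₀ u v w using 2 <;> simp [hπI, hπL, hε]
  have hdS : ∀ i ρ, labelSeq (d i) ρ ∈ S := by
    intro i ρ
    simp only [hSdef, hd, labelSeq, Finset.mem_filter, Finset.mem_univ, true_and]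
    rfl
  have hfree : ∀ i i' i'', (∀ ρ, ((d i).1 ρ, (d i').2.1 ρ, (d i'').2.2 ρ) ∈ S) →
      i = i' ∧ i' = i'' := by
    intro i i' i'' h
    apply (hxyz i i' i'').1
    have h0 : x i + y i + z i = 0 := (hxyz i i i).2 ⟨rfl, rfl⟩
    funext ρ
    have h0ρ := congrFun h0 ρ
    have hρ := h ρ
    simp only [hSdef, hd, Finset.mem_filter, Finset.mem_univ, true_and] at hρ
    simp only [Pi.add_apply, Pi.zero_apply] at h0ρ ⊢
    have hρ' : (y i ρ + z i ρ : ZMod 2) = y i' ρ + z i'' ρ := hρ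
    linear_combination h0ρ - hρ'
  -- the restriction `t₈^{⊗N} ≥ ⊕ᵢ ⟨2^N, 2^N, 2^N⟩`
  have hres := tensorRestrictsTo_kroneckerPow_matMulDirectSum_of_free_signed (K := ℂ) t₈
    Prod.fst Prod.fst Prod.fst S hS (fun _ => 2) (fun _ => 2) (fun _ => 2)
    (fun s u => (s.1, πI s u)) (fun s v => (s.2.1, πI s v)) (fun s w => (s.2.2, πL s w))
    (fun _ _ => 1) (fun _ _ => 1) ε (fun _ _ _ => rfl) (fun _ _ _ => rfl) (fun _ _ _ => rfl)
    (fun _ _ _ => one_mul 1) (fun _ _ _ => one_mul 1) hεL hmat d hdS hfree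
  -- asymptotic sum inequality and monotonicity of `R̃`
  have hchain := (sum_rpow_omega_le_asymptoticRank ℂ _ _ _).trans
    ((asymptoticRank_le_of_polyDegeneratesTo hres.polyDegeneratesTo).trans
      (asymptoticRank_kroneckerPow_le _ hN))
  simp only [Finset.prod_const, Finset.card_univ, Fintype.card_fin, Finset.sum_const,
    nsmul_eq_mul] at hchain
  -- `((2^N)^3)^{ω/3} = (2^ω)^N`
  have hvol : (((2 ^ N * 2 ^ N * 2 ^ N : ℕ) : ℝ)) ^ (omega ℂ / 3) = ((2 : ℝ) ^ omega ℂ) ^ N := by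
    have h3 : (((2 ^ N * 2 ^ N * 2 ^ N : ℕ) : ℝ)) = (2 : ℝ) ^ (3 * N) := by push_cast; ring
    rw [h3, ← Real.rpow_natCast (2 : ℝ) (3 * N), ← Real.rpow_mul (by norm_num : (0:ℝ) ≤ 2),
      ← Real.rpow_mul_natCast (by norm_num : (0:ℝ) ≤ 2)]
    congr 1
    push_cast
    ring
  rw [hvol] at hchain
  exact hchain

/-! ## The bound -/

/-- **`OctLaserBound`** (route OctonionicLaser, support item stmt-MatrixMultiplication-7934; the
idea card's THEOREM, unconditional): `(3/2^{2/3}) · 2^ω ≤ R̃(t₈)`, i.e.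
`ω ≤ log₂ R̃(t₈) − 0.91830`. From `card_mul_pow_omega_le_asymptoticRank_octonion_pow` and the
tricolored sum-free capacity of `𝔽₂ⁿ` (Kleinberg–Sawin–Speyer 2018, Thm. 2 at `q = 2`, proved in
tree: `kleinbergSawinSpeyer2018_two`): for `0 < δ < 3/2^{2/3}` and `N` large,
`((3/2^{2/3} − δ) 2^ω)^N ≤ s · 2^{Nω} ≤ R̃(t₈)^N`, so `(3/2^{2/3} − δ) 2^ω ≤ R̃(t₈)`; let `δ → 0`.
[cite: KleinbergSawinSpeyer2018, Thm. 2] -/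
theorem octLaserBound_proof :
    Summit.MatrixMultiplication.MatrixMultiplication.Theses.OctonionicLaser.OctLaserBound := by
  unfold Summit.MatrixMultiplication.MatrixMultiplication.Theses.OctonionicLaser.OctLaserBound
  set R : ℝ := asymptoticRank t₈ with hR
  have hR0 : 0 ≤ R := asymptoticRank_nonneg _
  set θ : ℝ := 3 / (2:ℝ) ^ ((2:ℝ) / 3) with hθ
  set P : ℝ := (2:ℝ) ^ omega ℂ with hP
  have hP0 : 0 < P := Real.rpow_pos_of_pos two_pos _
  have hθ0 : 0 < θ := by positivity
  -- `(θ − δ) · 2^ω ≤ R̃(t₈)` for every `0 < δ < θ`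
  have key : ∀ δ : ℝ, 0 < δ → δ < θ → (θ - δ) * P ≤ R := by
    intro δ hδ hδθ
    obtain ⟨n₀, hn₀⟩ := Literature.Combinatorics.Additive.kleinbergSawinSpeyer2018_two hδ hδθ
    set N := max n₀ 1 with hNdef
    obtain ⟨s, x, y, z, hfree, hs⟩ := hn₀ N (le_max_left _ _)
    have hN : 1 ≤ N := le_max_right _ _
    have h1 := card_mul_pow_omega_le_asymptoticRank_octonion_pow hN x y z hfree
    have h2 : ((θ - δ) * P) ^ N ≤ R ^ N := by
      rw [mul_pow]
      calc (θ - δ) ^ N * P ^ N ≤ s * P ^ N := mul_le_mul_of_nonneg_right hs (by positivity)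
        _ ≤ R ^ N := h1
    exact le_of_pow_le_pow_left₀ (by omega) hR0 h2
  -- `δ → 0`
  refine le_of_forall_pos_lt_add fun η hη => ?_
  set δ : ℝ := min (θ / 2) (η / (2 * P)) with hδ
  have hδ0 : 0 < δ := lt_min (by positivity) (by positivity)
  have hδθ : δ < θ := (min_le_left _ _).trans_lt (by linarith)
  have hk := key δ hδ0 hδθ
  have hδP : δ * P ≤ η / 2 := by
    calc δ * P ≤ η / (2 * P) * P := mul_le_mul_of_nonneg_right (min_le_right _ _) hP0.le
      _ = η / 2 := by field_simp
  calc θ * P = (θ - δ) * P + δ * P := by ring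
    _ ≤ R + η / 2 := add_le_add hk hδP
    _ < R + η := by linarith

end Octonion

end Summit.MatrixMultiplication.MatrixMultiplication.Theorems

end
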